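import Literature.NumberTheory.Automorphic.LieAlgebraGLStabilizer
import Literature.RingTheory.KrullDimension.TangentDimension
import Literature.NumberTheory.Automorphic.RootData
import HarnessLib

/-!
# The differential at `1` of an algebraic homomorphism `SL₂ → G` is a homomorphism of Lie algebras
(trunk T-AUTOMORPHIC, G25 AutomorphicL; Springer, *Linear Algebraic Groups*, 4.4.9, 4.4.15, 8.1.1)

Companion to `RootData.lean` (`IsAlgebraicSL2Hom φ`: `φ : SL₂(k) → G ≤ GL_n` with polynomial
coordinates; the one-parameter subgroups `unipotentUpperSL2`, `unipotentLowerSL2`; root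
homomorphisms `IsRootHom`), `LieAlgebraGL.lean` (`lieAlgebraGL`, `weightSpaceGL`, dual numbers
`dualPoint`, `dualMatrix`, and `coeffOneMatrix_mem_lieAlgebraGL`: velocities of polynomial curves lie
in `Lie(G)`) and `LieAlgebraGLStabilizer.lean` (dual-matrix calculus), namespace
`Literature.NumberTheory.Automorphic`. In the `k`-points vocabulary the hom property of `φ` is only
known on `k`-points, so the differential is handled through **polynomial curves** in `SL₂` and
reduction modulo `s²` (`epsRed : k[s] → k[ε]`), identities of polynomials being obtained from
identities of values over the infinite field `k` (`polyMatrix_ext`). Everything is proved: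

* `curveSL2 q hq` — the curve `s ↦ q(s)` of a polynomial matrix `q ∈ Mat₂(k[s])` with `det q = 1`;
  `qUpper`, `qLower`, `qHEF` with velocities `E`, `F`, `H + E - F` (`slE`, `slF`, `slH`,
  `sl2_relations`); `trace_velocity_eq_zero`;
* **`sl2Diff hφ : Mat₂(k) → Matₙ(k)`** — the differential `dφ` at `1` on a polynomial
  representation of `φ` (dual numbers), linear (`sl2DiffLin`); the chain rule `coeff_one_compFam` /
  `map_epsRed_compMat` (`φ(q(s)) ≡ 1 + ε dφ(q'(0))`), whence **`sl2Diff_mem_lieAlgebraGL`**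
  (`dφ` of a tangent vector of `SL₂` lies in `Lie(G)`, Springer 4.4.9);
* **`sl2Diff_conj`** — `Ad`-equivariance `dφ (g Y g⁻¹) = φ(g) (dφ Y) φ(g)⁻¹` (Springer 4.4.5 (ii));
* **`sl2Diff_lie`** — `dφ [Y', Y] = [dφ Y', dφ Y]` for tangent vectors of `SL₂` (Springer 4.4.9
  with 4.4.15: differentials of homomorphisms are Lie algebra homomorphisms), by differentiating
  the equivariance along a second curve (`adjugate_coeff_one`: the inverse curve has velocity `-Y'`);
* **`sl2Diff_slE_mem_weightSpaceGL`**, **`sl2Diff_slF_mem_weightSpaceGL`** — if `φ ∘ u⁺`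
  (`φ ∘ u⁻`) is a root homomorphism for `α` (`α⁻¹`) then `dφ E ∈ (𝔤𝔩ₙ)_α` (`dφ F ∈ (𝔤𝔩ₙ)_{α⁻¹}`)
  (Springer 8.1.1 (i): `Im du_α ⊆ 𝔤_α`), via `conj_sl2Diff_eq_smul`;
* **`sl2Diff_ne_zero_of_retraction`** — `dφ(q'(0)) ≠ 0` when `s ↦ φ(q(s))` has a regular
  retraction (the isomorphism clause of `IsRootHom`).

Consumer: `RootSpaceDimOne.lean` (the `𝔰𝔩₂`-triple `(dφ H, dφ E, dφ F)` and `dim 𝔤_α = 1`,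
Springer 8.1.2); `qHEF`, `slH` and `sl2_relations` are recorded here for that sequel.

Relation to the existing velocity machinery: `IsomorphismTheoremUniqueLie.lean` already attaches to an
algebraic one-parameter subgroup `u : 𝔾ₐ → G` its velocity (`IsAlgebraicAddHom.velocity`, with
`velocity_mem_lieAlgebraGL`, `IsRootHom.velocity_mem_weightSpaceGL` — Springer 8.1.1 (i) — and
`velocity_ne_zero` in characteristic `0`). For `u = φ ∘ u⁺` one has `sl2Diff hφ slE = hu.1.velocity`
(both are coefficient-one matrices of polynomial families representing the same curve,
`IsAlgebraicAddHom.velocity_eq` with `compFam hφ qUpper`); that file is *not* imported here to keep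
the import closure of the `SL₂`-calculus small (it pulls in the whole isomorphism-theorem proof
files), so the bridge lemma belongs downstream; the present weight and non-vanishing statements are
the `SL₂`-curve versions needed to get the *triple* `(dφ H, dφ E, dφ F)` with its bracket relations,
which the velocity of a single one-parameter subgroup does not provide. What is not here: the
independence of `sl2Diff hφ` of the chosen representation on all of `Mat₂(k)` (only on velocities,
`coeff_one_compFam`), and the diagonal one-parameter subgroup of `SL₂` (not a polynomial curve).

## Mathlib

`Polynomial.aeval`, `Polynomial.funext`, `MvPolynomial.comp_aeval`, `TrivSqZeroExt` / `DualNumber`,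
`Matrix.SpecialLinearGroup` (`coe_inv` = adjugate), `Matrix.adjugate_fin_two`, `RingHom.map_adjugate`,
`Literature.RingTheory.KrullDimension.dualNumberPoint`. Mathlib has no algebraic groups; nothing here
duplicates a Mathlib or Literature declaration (searched `sl2Diff`, `curveSL2`, `differential` +
`SpecialLinearGroup`).

## References

* T. A. Springer, *Linear Algebraic Groups*, 2nd ed., Progress in Mathematics 9, Birkhäuser
  (1998), 4.1.9 (3), 4.4.5 (ii), 4.4.9, 4.4.15, 8.1.1 (i) [SpringerLAG1998].
-/

noncomputable section

open Polynomial TrivSqZeroExt DualNumber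
open scoped MatrixGroups

namespace Literature.NumberTheory.Automorphic

variable {k : Type*} [Field k] {n : Type*} [Fintype n] [DecidableEq n]

/-! ### Polynomial matrices: evaluation, reduction modulo `s²`, identity of polynomials -/

section PolyMatrix

variable {m m' : Type*} [Fintype m] [DecidableEq m] [Fintype m'] [DecidableEq m']

/-- The reduction `k[s] → k[ε]`, `s ↦ ε` (keeps the constant and linear coefficients,
`aeval_eps_eq`). [folklore] -/
abbrev epsRed (k : Type*) [Field k] : k[X] →ₐ[k] k[ε] := Polynomial.aeval (ε : k[ε])

omit [Fintype n] [DecidableEq n] in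
/-- `epsRed p = p(0) + p'(0) ε`. [folklore] -/
lemma epsRed_apply (p : k[X]) : epsRed k p = inl (p.coeff 0) + inr (p.coeff 1) := aeval_eps_eq p

omit [Fintype n] [DecidableEq n] [Fintype m] [DecidableEq m] in
/-- Reduction of a polynomial matrix modulo `s²`: constant part plus `ε` times linear part.
[folklore] -/
lemma map_epsRed (Q : Matrix m m k[X]) :
    Q.map (epsRed k) = (Q.map fun p => p.coeff 0).map inl + (Q.map fun p => p.coeff 1).map inr := by
  ext i j : 1
  simp only [Matrix.map_apply, Matrix.add_apply]
  exact epsRed_apply (Q i j)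

omit [Fintype n] [DecidableEq n] [Fintype m] in
/-- A polynomial matrix with constant term `1` reduces to the dual matrix `1 + ε Q'(0)`.
[folklore] -/
lemma map_epsRed_eq_dualMatrix (Q : Matrix m m k[X]) (h0 : (Q.map fun p => p.coeff 0) = 1) :
    Q.map (epsRed k) = dualMatrix (Q.map fun p => p.coeff 1) := by
  rw [map_epsRed, h0, dualMatrix, Matrix.map_one _ (inl_zero k) rfl]

omit [Fintype n] [DecidableEq n] [Fintype m] [DecidableEq m] in
/-- Constant matrices reduce to themselves: `(M.map C).map epsRed = M.map inl`. [folklore] -/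
lemma map_C_map_epsRed (M : Matrix m m k) :
    (M.map (C : k → k[X])).map (epsRed k) = M.map (algebraMap k k[ε]) := by
  ext i j : 1
  simp [Matrix.map_apply, TrivSqZeroExt.algebraMap_eq_inl]

omit [Fintype n] [DecidableEq n] [Fintype m] [DecidableEq m] in
/-- Constant matrices evaluate to themselves. [folklore] -/
lemma map_C_map_eval (M : Matrix m m k) (s : k) :
    (M.map (C : k → k[X])).map (Polynomial.eval s) = M := by
  ext i j : 1
  simp [Matrix.map_apply]

omit [Fintype n] [DecidableEq n] [Fintype m] [DecidableEq m] [Fintype m'] [DecidableEq m'] in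
/-- **Identity of polynomial matrices from identity of values** (over an infinite field). [folklore] -/
lemma polyMatrix_ext [Infinite k] {Q Q' : Matrix m m' k[X]}
    (h : ∀ s : k, Q.map (Polynomial.eval s) = Q'.map (Polynomial.eval s)) : Q = Q' := by
  ext i j : 1
  exact Polynomial.funext fun s => by
    have := congrFun (congrFun (h s) i) j
    simpa [Matrix.map_apply] using this

omit [Fintype n] [DecidableEq n] [Fintype m] [DecidableEq m] in
/-- The `ε`-part of a reduced polynomial matrix is its matrix of linear coefficients. [folklore] -/
lemma snd_map_epsRed (Q : Matrix m m k[X]) (i j : m) : snd (Q.map (epsRed k) i j) = (Q i j).coeff 1 := by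
  rw [Matrix.map_apply, epsRed_apply, snd_add, snd_inl, snd_inr, zero_add]

omit [Fintype n] [DecidableEq n] [Fintype m] in
/-- Extracting `A` from `1 + ε A`. [folklore] -/
lemma snd_dualMatrix_apply (A : Matrix m m k) (i j : m) : snd (dualMatrix A i j) = A i j := by
  rw [dualMatrix, Matrix.add_apply, snd_add, Matrix.map_apply, snd_inr, Matrix.one_apply]
  split_ifs <;> simp

omit [Fintype n] [DecidableEq n] [Fintype m] in
/-- `dualMatrix` is injective. [folklore] -/
lemma dualMatrix_injective : Function.Injective (dualMatrix : Matrix m m k → Matrix m m k[ε]) := by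
  intro A B h
  ext i j
  rw [← snd_dualMatrix_apply A i j, h, snd_dualMatrix_apply]

omit [Fintype n] [DecidableEq n] in
/-- The conjugation identity `(1 + ε A) M (1 - ε A) = M + ε (A M - M A)` over `k[ε]`. [folklore] -/
lemma dualMatrix_mul_map_mul_dualMatrix_neg (A M : Matrix m m k) :
    dualMatrix A * M.map (algebraMap k k[ε]) * dualMatrix (-A) =
      M.map (algebraMap k k[ε]) + (A * M - M * A).map inr := by
  rw [dualMatrix, dualMatrix, map_inr_neg]
  have e1 : A.map inr * M.map (algebraMap k k[ε]) = (A * M).map inr := map_inr_mul_map_algebraMap A M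
  have e2 : M.map (algebraMap k k[ε]) * A.map inr = (M * A).map inr := map_algebraMap_mul_map_inr M A
  have e3 : (A * M).map (inr : k → k[ε]) * A.map inr = 0 := map_inr_mul_map_inr _ _
  have e : (1 + A.map (inr : k → k[ε])) * M.map (algebraMap k k[ε]) * (1 + -A.map inr) =
      M.map (algebraMap k k[ε]) + (A.map inr * M.map (algebraMap k k[ε]) -
        M.map (algebraMap k k[ε]) * A.map inr) -
        A.map inr * M.map (algebraMap k k[ε]) * A.map inr := by
    noncomm_ring
  rw [e, e1, e2, e3, sub_zero, ← map_inr_sub]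

end PolyMatrix

/-! ### More polynomial-matrix calculus -/

section PolyMatrix2

variable {m : Type*} [Fintype m] [DecidableEq m]

omit [Fintype n] [DecidableEq n] [DecidableEq m] in
/-- Coefficients of `M Q N` for constant `M, N`: `coeff_d (M Q N) = M (coeff_d Q) N`. [folklore] -/
lemma map_coeff_C_mul_mul_C (M N : Matrix m m k) (Q : Matrix m m k[X]) (d : ℕ) :
    ((M.map (C : k → k[X])) * Q * (N.map (C : k → k[X]))).map (fun p => p.coeff d) =
      M * Q.map (fun p => p.coeff d) * N := by
  ext i j : 1
  simp only [Matrix.map_apply, Matrix.mul_apply, Polynomial.finsetSum_coeff, Polynomial.coeff_mul_C,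
    Polynomial.coeff_C_mul, Finset.sum_mul]

omit [Fintype n] [DecidableEq n] [Fintype m] [DecidableEq m] in
/-- `coeff 0 = eval 0` on matrices. [folklore] -/
lemma map_coeff_zero_eq_map_eval_zero (Q : Matrix m m k[X]) :
    Q.map (fun p => p.coeff 0) = Q.map (Polynomial.eval 0) := by
  ext i j : 1
  simp [Matrix.map_apply, Polynomial.coeff_zero_eq_eval_zero]

omit [Fintype n] [DecidableEq n] [Fintype m] [DecidableEq m] in
/-- Reparametrising `s ↦ c s` multiplies the linear coefficients by `c`. [folklore] -/
lemma map_coeff_one_comp_C_mul_X (Q : Matrix m m k[X]) (c : k) :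
    (Q.map fun p => p.comp (C c * X)).map (fun p => p.coeff 1) = c • Q.map (fun p => p.coeff 1) := by
  ext i j : 1
  simp only [Matrix.map_apply, Matrix.smul_apply, smul_eq_mul, Polynomial.comp_C_mul_X_coeff, pow_one]
  exact mul_comm _ _

omit [Fintype n] [DecidableEq n] [Fintype m] [DecidableEq m] in
/-- Evaluating a reparametrised matrix. [folklore] -/
lemma map_eval_comp_C_mul_X (Q : Matrix m m k[X]) (c s : k) :
    (Q.map fun p => p.comp (C c * X)).map (Polynomial.eval s) = Q.map (Polynomial.eval (c * s)) := by
  ext i j : 1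
  simp [Matrix.map_apply, Polynomial.eval_comp]

end PolyMatrix2

/-! ### Polynomial curves in `SL₂` through `1` -/

section Curves

/-- A polynomial matrix `q(s) ∈ Mat₂(k[s])` with `det q = 1` and `q(0) = 1` defines the curve
`s ↦ q(s)` in `SL₂(k)` through `1`. [folklore] -/
def curveSL2 (q : Matrix (Fin 2) (Fin 2) k[X]) (hq : q.det = 1) (s : k) : SL(2, k) :=
  ⟨q.map (Polynomial.eval s), by
    rw [← Polynomial.coe_evalRingHom, ← RingHom.mapMatrix_apply, ← RingHom.map_det, hq, map_one]⟩

/-- The matrix of `curveSL2 q hq s` is `q(s)`. [folklore] -/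
@[simp] lemma coe_curveSL2 (q : Matrix (Fin 2) (Fin 2) k[X]) (hq : q.det = 1) (s : k) :
    ((curveSL2 q hq s : SL(2, k)) : Matrix (Fin 2) (Fin 2) k) = q.map (Polynomial.eval s) := rfl

/-- `q(0) = 1` gives `curveSL2 q hq 0 = 1`. [folklore] -/
lemma curveSL2_zero (q : Matrix (Fin 2) (Fin 2) k[X]) (hq : q.det = 1)
    (h0 : q.map (fun p => p.coeff 0) = 1) : curveSL2 q hq 0 = 1 :=
  Subtype.ext (by rw [coe_curveSL2, ← map_coeff_zero_eq_map_eval_zero, h0]; rfl)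

/-- The velocity `q'(0)` of a curve with `q(0) = 1` has trace zero: reduce `det q = 1` modulo `s²`
(`det (1 + ε Y) = 1 + ε tr Y`). [folklore] -/
lemma trace_velocity_eq_zero (q : Matrix (Fin 2) (Fin 2) k[X]) (hq : q.det = 1)
    (h0 : q.map (fun p => p.coeff 0) = 1) : Matrix.trace (q.map fun p => p.coeff 1) = 0 := by
  have h := congrArg (epsRed k) hq
  rw [map_one, AlgHom.map_det] at h
  have h' : (q.map (epsRed k)).det = 1 := h
  rw [map_epsRed_eq_dualMatrix q h0, det_dualMatrix] at h'
  have h2 := congrArg snd h'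
  rwa [snd_add, snd_inl, snd_inr, zero_add, snd_one] at h2

/-- The upper unipotent curve `s ↦ (1 s; 0 1)`. [folklore] -/
def qUpper : Matrix (Fin 2) (Fin 2) k[X] := !![1, X; 0, 1]

/-- The lower unipotent curve `s ↦ (1 0; s 1)`. [folklore] -/
def qLower : Matrix (Fin 2) (Fin 2) k[X] := !![1, 0; X, 1]

/-- The curve `s ↦ (1+s s; -s 1-s)`, with velocity `H + E - F`. [folklore] -/
def qHEF : Matrix (Fin 2) (Fin 2) k[X] := !![1 + X, X; -X, 1 - X]

/-- `E = (0 1; 0 0) ∈ 𝔰𝔩₂`. [folklore] -/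
def slE : Matrix (Fin 2) (Fin 2) k := !![0, 1; 0, 0]
/-- `F = (0 0; 1 0) ∈ 𝔰𝔩₂`. [folklore] -/
def slF : Matrix (Fin 2) (Fin 2) k := !![0, 0; 1, 0]
/-- `H = (1 0; 0 -1) ∈ 𝔰𝔩₂`. [folklore] -/
def slH : Matrix (Fin 2) (Fin 2) k := !![1, 0; 0, -1]

/-- `det qUpper = 1`. [folklore] -/
lemma det_qUpper : (qUpper : Matrix (Fin 2) (Fin 2) k[X]).det = 1 := by simp [qUpper, Matrix.det_fin_two]
/-- `det qLower = 1`. [folklore] -/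
lemma det_qLower : (qLower : Matrix (Fin 2) (Fin 2) k[X]).det = 1 := by simp [qLower, Matrix.det_fin_two]
/-- `det qHEF = 1`. [folklore] -/
lemma det_qHEF : (qHEF : Matrix (Fin 2) (Fin 2) k[X]).det = 1 := by
  simp [qHEF, Matrix.det_fin_two]; ring

/-- `qUpper(0) = 1`. [folklore] -/
lemma qUpper_coeff_zero : (qUpper : Matrix (Fin 2) (Fin 2) k[X]).map (fun p => p.coeff 0) = 1 := by
  ext i j; fin_cases i <;> fin_cases j <;> simp [qUpper]
/-- `qLower(0) = 1`. [folklore] -/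
lemma qLower_coeff_zero : (qLower : Matrix (Fin 2) (Fin 2) k[X]).map (fun p => p.coeff 0) = 1 := by
  ext i j; fin_cases i <;> fin_cases j <;> simp [qLower]
/-- `qHEF(0) = 1`. [folklore] -/
lemma qHEF_coeff_zero : (qHEF : Matrix (Fin 2) (Fin 2) k[X]).map (fun p => p.coeff 0) = 1 := by
  ext i j; fin_cases i <;> fin_cases j <;> simp [qHEF]

/-- `qUpper'(0) = E`. [folklore] -/
lemma qUpper_coeff_one : (qUpper : Matrix (Fin 2) (Fin 2) k[X]).map (fun p => p.coeff 1) = slE := by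
  ext i j; fin_cases i <;> fin_cases j <;> simp [qUpper, slE, Polynomial.coeff_one]
/-- `qLower'(0) = F`. [folklore] -/
lemma qLower_coeff_one : (qLower : Matrix (Fin 2) (Fin 2) k[X]).map (fun p => p.coeff 1) = slF := by
  ext i j; fin_cases i <;> fin_cases j <;> simp [qLower, slF, Polynomial.coeff_one]
/-- `qHEF'(0) = H + E - F`. [folklore] -/
lemma qHEF_coeff_one :
    (qHEF : Matrix (Fin 2) (Fin 2) k[X]).map (fun p => p.coeff 1) = slH + slE - slF := by
  ext i j; fin_cases i <;> fin_cases j <;> simp [qHEF, slH, slE, slF, Polynomial.coeff_one]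

/-- The upper curve is the standard upper one-parameter subgroup. [folklore] -/
lemma curveSL2_qUpper (s : k) :
    curveSL2 qUpper det_qUpper s = unipotentUpperSL2 (Multiplicative.ofAdd s) := by
  apply Subtype.ext
  rw [coe_curveSL2, coe_unipotentUpperSL2, toAdd_ofAdd]
  ext i j; fin_cases i <;> fin_cases j <;> simp [qUpper]

/-- The lower curve is the standard lower one-parameter subgroup. [folklore] -/
lemma curveSL2_qLower (s : k) :
    curveSL2 qLower det_qLower s = unipotentLowerSL2 (Multiplicative.ofAdd s) := by
  apply Subtype.ext
  rw [coe_curveSL2, coe_unipotentLowerSL2, toAdd_ofAdd]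
  ext i j; fin_cases i <;> fin_cases j <;> simp [qLower]

/-- The `𝔰𝔩₂` relations `[E, F] = H`, `[H, E] = 2E`, `[H, F] = -2F`. [folklore] -/
lemma sl2_relations :
    (slE * slF - slF * slE : Matrix (Fin 2) (Fin 2) k) = slH ∧
      (slH * slE - slE * slH : Matrix (Fin 2) (Fin 2) k) = 2 • slE ∧
      (slH * slF - slF * slH : Matrix (Fin 2) (Fin 2) k) = -(2 • slF) := by
  refine ⟨?_, ?_, ?_⟩ <;>
  · ext i j; fin_cases i <;> fin_cases j <;> simp [slE, slF, slH] <;> norm_num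

end Curves

/-! ### The differential of an algebraic homomorphism `SL₂ → G` -/

section Differential

variable {G : Subgroup (GL n k)} {φ : SL(2, k) →* ↥G} (hφ : IsAlgebraicSL2Hom φ)

/-- The entries of a `2 × 2` matrix as a function on `Fin 2 × Fin 2` (the format of
`IsAlgebraicSL2Hom`). [folklore] -/
abbrev ent {R : Type*} (M : Matrix (Fin 2) (Fin 2) R) : Fin 2 × Fin 2 → R := fun ij => M ij.1 ij.2

/-- The `k[ε]`-valued point `1 + ε Y` of `Mat₂` in entry coordinates. [folklore] -/
abbrev sl2Point (Y : Matrix (Fin 2) (Fin 2) k) : Fin 2 × Fin 2 → k[ε] :=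
  Literature.RingTheory.KrullDimension.dualNumberPoint (ent (1 : Matrix (Fin 2) (Fin 2) k)) (ent Y)

include hφ in
/-- A polynomial representation `Pc` of `φ` (chosen once and for all from `IsAlgebraicSL2Hom`).
[folklore] -/
lemma glCoordFun_eq_eval_choose : ∀ (g : SL(2, k)) (c : GLCoord n),
    glCoordFun ((φ g : ↥G) : GL n k) c =
      MvPolynomial.eval (fun ij => (g : Matrix (Fin 2) (Fin 2) k) ij.1 ij.2) (hφ.choose c) :=
  hφ.choose_spec

/-- **The differential `dφ : 𝔰𝔩₂ → 𝔤𝔩ₙ` at `1`** of the algebraic homomorphism `φ : SL₂ → G ≤ GL_n`,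
computed on a polynomial representation `Pc` of `φ` with dual numbers: `(dφ Y)_{ij}` is the `ε`-part
of `Pc_{ij} (1 + ε Y)` (Springer 4.4.9: the differential of a homomorphism of algebraic groups;
4.1.9 (3)). On tangent vectors of `SL₂` this does not depend on the choice of `Pc`
(`coeff_one_compFam`). [cite: SpringerLAG1998, 4.4.9] -/
def sl2Diff (Y : Matrix (Fin 2) (Fin 2) k) : Matrix n n k :=
  Matrix.of fun i j => snd (MvPolynomial.aeval (sl2Point Y) (hφ.choose (Sum.inl (i, j))))

/-- `dφ` is linear: `(dφ Y)_{ij} = ∑_{ab} (∂ Pc_{ij}/∂y_{ab})(1) Y_{ab}`. [folklore] -/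
lemma sl2Diff_apply (Y : Matrix (Fin 2) (Fin 2) k) (i j : n) :
    sl2Diff hφ Y i j = ∑ ab : Fin 2 × Fin 2, MvPolynomial.eval (ent (1 : Matrix (Fin 2) (Fin 2) k))
      (MvPolynomial.pderiv ab (hφ.choose (Sum.inl (i, j)))) * Y ab.1 ab.2 := by
  rw [sl2Diff, Matrix.of_apply, Literature.RingTheory.KrullDimension.snd_aeval_dualNumberPoint,
    Literature.RingTheory.KrullDimension.linearFormOfVector_apply]

/-- `dφ (Y + Y') = dφ Y + dφ Y'`. [folklore] -/
lemma sl2Diff_add (Y Y' : Matrix (Fin 2) (Fin 2) k) : sl2Diff hφ (Y + Y') = sl2Diff hφ Y + sl2Diff hφ Y' := by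
  ext i j
  simp only [sl2Diff_apply, Matrix.add_apply, mul_add, Finset.sum_add_distrib]

/-- `dφ (c Y) = c dφ Y`. [folklore] -/
lemma sl2Diff_smul (c : k) (Y : Matrix (Fin 2) (Fin 2) k) : sl2Diff hφ (c • Y) = c • sl2Diff hφ Y := by
  ext i j
  simp only [sl2Diff_apply, Matrix.smul_apply, smul_eq_mul, Finset.mul_sum]
  exact Finset.sum_congr rfl fun ab _ => by ring

/-- `dφ (-Y) = - dφ Y`. [folklore] -/
lemma sl2Diff_neg (Y : Matrix (Fin 2) (Fin 2) k) : sl2Diff hφ (-Y) = -sl2Diff hφ Y := by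
  rw [← neg_one_smul k Y, sl2Diff_smul, neg_one_smul]

/-- `dφ (Y - Y') = dφ Y - dφ Y'`. [folklore] -/
lemma sl2Diff_sub (Y Y' : Matrix (Fin 2) (Fin 2) k) : sl2Diff hφ (Y - Y') = sl2Diff hφ Y - sl2Diff hφ Y' := by
  rw [sub_eq_add_neg, sl2Diff_add, sl2Diff_neg, ← sub_eq_add_neg]

/-- `dφ` as a `k`-linear map. [folklore] -/
def sl2DiffLin : Matrix (Fin 2) (Fin 2) k →ₗ[k] Matrix n n k where
  toFun := sl2Diff hφ
  map_add' := sl2Diff_add hφ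
  map_smul' := sl2Diff_smul hφ

/-! #### The composite polynomial family of `φ ∘ (curve)` -/

/-- The coordinates of `φ (q(s))` as polynomials in `s`: `Pc` with the entries of `q` substituted.
[folklore] -/
def compFam (q : Matrix (Fin 2) (Fin 2) k[X]) (c : GLCoord n) : k[X] :=
  MvPolynomial.aeval (ent q) (hφ.choose c)

/-- `compFam` computes the coordinates of `φ (q(s))`. [folklore] -/
lemma eval_compFam (q : Matrix (Fin 2) (Fin 2) k[X]) (hq : q.det = 1) (s : k) (c : GLCoord n) :
    (compFam hφ q c).eval s = glCoordFun ((φ (curveSL2 q hq s) : ↥G) : GL n k) c := by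
  rw [glCoordFun_eq_eval_choose hφ, compFam, MvPolynomial.aeval_def, Polynomial.algebraMap_eq, eval_mvPolynomialEval₂_C]
  rfl

/-- The matrix part of the composite family. [folklore] -/
def compMat (q : Matrix (Fin 2) (Fin 2) k[X]) : Matrix n n k[X] :=
  Matrix.of fun i j => compFam hφ q (Sum.inl (i, j))

/-- `compMat q (s) = φ (q(s))` as matrices. [folklore] -/
lemma map_eval_compMat (q : Matrix (Fin 2) (Fin 2) k[X]) (hq : q.det = 1) (s : k) :
    (compMat hφ q).map (Polynomial.eval s) =
      (((φ (curveSL2 q hq s) : ↥G) : GL n k) : Matrix n n k) := by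
  ext i j : 1
  rw [Matrix.map_apply, compMat, Matrix.of_apply, eval_compFam hφ q hq]
  rfl

/-- Reduction modulo `s²` of the composite family: `Pc` evaluated at the point `1 + ε q'(0)`.
[folklore] -/
lemma epsRed_compFam (q : Matrix (Fin 2) (Fin 2) k[X]) (h0 : q.map (fun p => p.coeff 0) = 1)
    (c : GLCoord n) :
    epsRed k (compFam hφ q c) = MvPolynomial.aeval (sl2Point (q.map fun p => p.coeff 1)) (hφ.choose c) := by
  rw [compFam, ← AlgHom.comp_apply, MvPolynomial.comp_aeval]
  have hpt : (fun i => epsRed k (ent q i)) = sl2Point (q.map fun p => p.coeff 1) := by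
    funext ij
    rw [epsRed_apply, sl2Point, Literature.RingTheory.KrullDimension.dualNumberPoint]
    have h := congrFun (congrFun h0 ij.1) ij.2
    rw [Matrix.map_apply] at h
    rw [h]
    rfl
  rw [hpt]

/-- **The chain rule**: the linear coefficients of the coordinates of `φ (q(s))` are the entries of
`dφ (q'(0))` (for `q(0) = 1`). [folklore] -/
theorem coeff_one_compFam (q : Matrix (Fin 2) (Fin 2) k[X]) (h0 : q.map (fun p => p.coeff 0) = 1)
    (i j : n) : (compFam hφ q (Sum.inl (i, j))).coeff 1 = sl2Diff hφ (q.map fun p => p.coeff 1) i j := by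
  have h := congrArg snd (epsRed_compFam hφ q h0 (Sum.inl (i, j)))
  rwa [epsRed_apply, snd_add, snd_inl, snd_inr, zero_add] at h

/-- Matrix form of the chain rule: `compMat q ≡ 1 + ε dφ (q'(0)) (mod s²)`. [folklore] -/
theorem map_epsRed_compMat (q : Matrix (Fin 2) (Fin 2) k[X]) (hq : q.det = 1)
    (h0 : q.map (fun p => p.coeff 0) = 1) :
    (compMat hφ q).map (epsRed k) = dualMatrix (sl2Diff hφ (q.map fun p => p.coeff 1)) := by
  have h0' : (compMat hφ q).map (fun p => p.coeff 0) = 1 := by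
    rw [map_coeff_zero_eq_map_eval_zero, map_eval_compMat hφ q hq, curveSL2_zero q hq h0, map_one]
    rfl
  rw [map_epsRed_eq_dualMatrix _ h0']
  congr 1
  ext i j : 1
  rw [Matrix.map_apply, compMat, Matrix.of_apply, coeff_one_compFam hφ q h0]

/-- **`dφ` maps tangent vectors of `SL₂` into `Lie(G)`**: the velocity of the curve `s ↦ φ (q(s))`
in `G` (`coeffOneMatrix_mem_lieAlgebraGL`). [cite: SpringerLAG1998, 4.4.9] -/
theorem sl2Diff_mem_lieAlgebraGL [Infinite k] (q : Matrix (Fin 2) (Fin 2) k[X]) (hq : q.det = 1)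
    (h0 : q.map (fun p => p.coeff 0) = 1) : sl2Diff hφ (q.map fun p => p.coeff 1) ∈ lieAlgebraGL G := by
  have h := coeffOneMatrix_mem_lieAlgebraGL (G := G) (fun s => φ (curveSL2 q hq s)) (compFam hφ q)
    (fun s c => (eval_compFam hφ q hq s c).symm) (by rw [curveSL2_zero q hq h0, map_one])
  have he : (Matrix.of fun i j => (compFam hφ q (Sum.inl (i, j))).coeff 1) =
      sl2Diff hφ (q.map fun p => p.coeff 1) := by
    ext i j : 1
    rw [Matrix.of_apply, coeff_one_compFam hφ q h0]
  rwa [he] at h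

end Differential

/-! ### `dφ` is `Ad`-equivariant and preserves brackets -/

section Bracket

variable {G : Subgroup (GL n k)} {φ : SL(2, k) →* ↥G} (hφ : IsAlgebraicSL2Hom φ)

/-- The matrix of `φ g` in `GL n k`. [folklore] -/
abbrev phiMat (φ : SL(2, k) →* ↥G) (g : SL(2, k)) : Matrix n n k := (((φ g : ↥G) : GL n k) : Matrix n n k)

/-- `phiMat` is multiplicative. [folklore] -/
lemma phiMat_mul (g h : SL(2, k)) : phiMat φ (g * h) = phiMat φ g * phiMat φ h := by
  rw [phiMat, map_mul, Subgroup.coe_mul, Units.val_mul]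

/-- `phiMat g⁻¹ = (phiMat g)⁻¹` (as the `GL`-inverse). [folklore] -/
lemma phiMat_inv (g : SL(2, k)) : phiMat φ g⁻¹ = ((((φ g : ↥G) : GL n k)⁻¹ : GL n k) : Matrix n n k) := by
  rw [phiMat, map_inv, Subgroup.coe_inv]

/-- The conjugated curve `s ↦ g q(s) g⁻¹`. [folklore] -/
def conjCurve (g : SL(2, k)) (q : Matrix (Fin 2) (Fin 2) k[X]) : Matrix (Fin 2) (Fin 2) k[X] :=
  (g : Matrix (Fin 2) (Fin 2) k).map C * q * ((g⁻¹ : SL(2, k)) : Matrix (Fin 2) (Fin 2) k).map C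

/-- `det (g q g⁻¹) = 1`. [folklore] -/
lemma det_conjCurve (g : SL(2, k)) (q : Matrix (Fin 2) (Fin 2) k[X]) (hq : q.det = 1) :
    (conjCurve g q).det = 1 := by
  have hC : ∀ M : Matrix (Fin 2) (Fin 2) k, (M.map (C : k → k[X])).det = C M.det := fun M => by
    change ((Polynomial.C : k →+* k[X]).mapMatrix M).det = _
    rw [← RingHom.map_det]
  rw [conjCurve, Matrix.det_mul, Matrix.det_mul, hq, mul_one, hC, hC, Matrix.SpecialLinearGroup.det_coe,
    Matrix.SpecialLinearGroup.det_coe, map_one, mul_one]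

/-- `(g q g⁻¹)(0) = 1`. [folklore] -/
lemma conjCurve_coeff_zero (g : SL(2, k)) (q : Matrix (Fin 2) (Fin 2) k[X])
    (h0 : q.map (fun p => p.coeff 0) = 1) : (conjCurve g q).map (fun p => p.coeff 0) = 1 := by
  rw [conjCurve, map_coeff_C_mul_mul_C, h0, Matrix.mul_one, ← Matrix.SpecialLinearGroup.coe_mul,
    mul_inv_cancel, Matrix.SpecialLinearGroup.coe_one]

/-- The velocity of `g q g⁻¹` is `g q'(0) g⁻¹`. [folklore] -/
lemma conjCurve_coeff_one (g : SL(2, k)) (q : Matrix (Fin 2) (Fin 2) k[X]) :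
    (conjCurve g q).map (fun p => p.coeff 1) =
      (g : Matrix (Fin 2) (Fin 2) k) * q.map (fun p => p.coeff 1) * ((g⁻¹ : SL(2, k)) : Matrix (Fin 2) (Fin 2) k) := by
  rw [conjCurve, map_coeff_C_mul_mul_C]

/-- The points of the conjugated curve. [folklore] -/
lemma curveSL2_conjCurve (g : SL(2, k)) (q : Matrix (Fin 2) (Fin 2) k[X]) (hq : q.det = 1) (s : k) :
    curveSL2 (conjCurve g q) (det_conjCurve g q hq) s = g * curveSL2 q hq s * g⁻¹ := by
  apply Subtype.ext
  rw [coe_curveSL2, conjCurve, Matrix.SpecialLinearGroup.coe_mul, Matrix.SpecialLinearGroup.coe_mul,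
    coe_curveSL2, ← Polynomial.coe_evalRingHom, Matrix.map_mul, Matrix.map_mul, Polynomial.coe_evalRingHom,
    map_C_map_eval, map_C_map_eval]

/-- **`dφ` is `Ad`-equivariant**: `dφ (g Y g⁻¹) = φ(g) (dφ Y) φ(g)⁻¹` for `g ∈ SL₂(k)` and `Y` the
velocity of a polynomial curve in `SL₂` through `1` (compare the curves `s ↦ φ (g q(s) g⁻¹)` and
`s ↦ φ(g) φ(q(s)) φ(g)⁻¹`, equal pointwise, hence as polynomial matrices, hence modulo `s²`;
Springer 4.4.11, Exercise (7): `dφ (Ad(x) X) = Ad(φ x) (dφ X)`, with `Ad` as in 4.4.5 (ii)).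
[cite: SpringerLAG1998, 4.4.11 (7) and 4.4.9] -/
theorem sl2Diff_conj [Infinite k] (g : SL(2, k)) (q : Matrix (Fin 2) (Fin 2) k[X]) (hq : q.det = 1)
    (h0 : q.map (fun p => p.coeff 0) = 1) :
    sl2Diff hφ ((g : Matrix (Fin 2) (Fin 2) k) * q.map (fun p => p.coeff 1) * ((g⁻¹ : SL(2, k)) : Matrix (Fin 2) (Fin 2) k)) =
      phiMat φ g * sl2Diff hφ (q.map fun p => p.coeff 1) * phiMat φ g⁻¹ := by
  -- the two polynomial matrices
  have hpoly : compMat hφ (conjCurve g q) =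
      (phiMat φ g).map C * compMat hφ q * (phiMat φ g⁻¹).map C := by
    refine polyMatrix_ext fun s => ?_
    rw [map_eval_compMat hφ _ (det_conjCurve g q hq), curveSL2_conjCurve, ← Polynomial.coe_evalRingHom,
      Matrix.map_mul, Matrix.map_mul, Polynomial.coe_evalRingHom, map_C_map_eval, map_C_map_eval,
      map_eval_compMat hφ q hq]
    change phiMat φ (g * curveSL2 q hq s * g⁻¹) = _
    rw [phiMat_mul, phiMat_mul]
  have h : (compMat hφ (conjCurve g q)).map (epsRed k) =
      ((phiMat φ g).map C * compMat hφ q * (phiMat φ g⁻¹).map C).map (epsRed k) := by rw [hpoly]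
  rw [map_epsRed_compMat hφ _ (det_conjCurve g q hq) (conjCurve_coeff_zero g q h0), conjCurve_coeff_one,
    ← AlgHom.coe_toRingHom, Matrix.map_mul, Matrix.map_mul, AlgHom.coe_toRingHom, map_C_map_epsRed,
    map_C_map_epsRed, map_epsRed_compMat hφ q hq h0, phiMat_inv, conj_dualMatrix] at h
  rw [phiMat_inv]
  exact dualMatrix_injective h

end Bracket

/-! ### The inverse curve and the bracket -/

section Bracket2

variable {G : Subgroup (GL n k)} {φ : SL(2, k) →* ↥G} (hφ : IsAlgebraicSL2Hom φ)

/-- `det (adj q) = 1` for `det q = 1` (`2 × 2`). [folklore] -/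
lemma det_adjugate_eq_one (q : Matrix (Fin 2) (Fin 2) k[X]) (hq : q.det = 1) : q.adjugate.det = 1 := by
  rw [Matrix.det_adjugate, hq, one_pow]

/-- `(adj q)(0) = 1` for `q(0) = 1`. [folklore] -/
lemma adjugate_coeff_zero (q : Matrix (Fin 2) (Fin 2) k[X]) (h0 : q.map (fun p => p.coeff 0) = 1) :
    q.adjugate.map (fun p => p.coeff 0) = 1 := by
  rw [map_coeff_zero_eq_map_eval_zero]
  change (Polynomial.evalRingHom 0).mapMatrix q.adjugate = 1
  rw [RingHom.map_adjugate, RingHom.mapMatrix_apply, Polynomial.coe_evalRingHom,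
    ← map_coeff_zero_eq_map_eval_zero, h0, Matrix.adjugate_one]

/-- The velocity of `adj q` is `-q'(0)` (for `q(0) = 1`, `det q = 1`, using `tr q'(0) = 0`). [folklore] -/
lemma adjugate_coeff_one (q : Matrix (Fin 2) (Fin 2) k[X]) (hq : q.det = 1)
    (h0 : q.map (fun p => p.coeff 0) = 1) :
    q.adjugate.map (fun p => p.coeff 1) = -(q.map fun p => p.coeff 1) := by
  have htr := trace_velocity_eq_zero q hq h0
  rw [Matrix.trace_fin_two, Matrix.map_apply, Matrix.map_apply] at htr
  rw [Matrix.adjugate_fin_two]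
  ext i j
  fin_cases i <;> fin_cases j <;> simp [Matrix.map_apply]
  · linear_combination htr
  · linear_combination htr

/-- Evaluation commutes with the adjugate. [folklore] -/
lemma map_eval_adjugate (q : Matrix (Fin 2) (Fin 2) k[X]) (s : k) :
    q.adjugate.map (Polynomial.eval s) = (q.map (Polynomial.eval s)).adjugate := by
  change (Polynomial.evalRingHom s).mapMatrix q.adjugate = _
  rw [RingHom.map_adjugate]
  rfl

/-- The inverse curve: `curveSL2 (adj q) s = (curveSL2 q s)⁻¹`. [folklore] -/
lemma curveSL2_adjugate (q : Matrix (Fin 2) (Fin 2) k[X]) (hq : q.det = 1) (s : k) :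
    curveSL2 q.adjugate (det_adjugate_eq_one q hq) s = (curveSL2 q hq s)⁻¹ := by
  apply Subtype.ext
  rw [coe_curveSL2, Matrix.SpecialLinearGroup.coe_inv, coe_curveSL2, map_eval_adjugate]

/-- The coefficients of `dφ`: `(dφ M)_{ij} = ∑_{ab} coef_{ab,ij} M_{ab}`. [folklore] -/
abbrev dcoef (ab : Fin 2 × Fin 2) (i j : n) : k :=
  MvPolynomial.eval (ent (1 : Matrix (Fin 2) (Fin 2) k)) (MvPolynomial.pderiv ab (hφ.choose (Sum.inl (i, j))))

/-- **`dφ` preserves brackets on tangent vectors of `SL₂`**: for velocities `Y', Y` of polynomial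
curves in `SL₂` through `1`, `dφ [Y', Y] = [dφ Y', dφ Y]` (differentiate the `Ad`-equivariance
`dφ (q'(s) Y q'(s)⁻¹) = φ(q'(s)) (dφ Y) φ(q'(s))⁻¹` at `s = 0`, modulo `s²`; Springer 4.4.9 with
4.4.15: the differential of a homomorphism of algebraic groups is a homomorphism of Lie algebras).
[cite: SpringerLAG1998, 4.4.9] -/
theorem sl2Diff_lie [Infinite k] (q' q : Matrix (Fin 2) (Fin 2) k[X]) (hq' : q'.det = 1)
    (h0' : q'.map (fun p => p.coeff 0) = 1) (hq : q.det = 1) (h0 : q.map (fun p => p.coeff 0) = 1) :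
    sl2Diff hφ (q'.map (fun p => p.coeff 1) * q.map (fun p => p.coeff 1) -
        q.map (fun p => p.coeff 1) * q'.map (fun p => p.coeff 1)) =
      sl2Diff hφ (q'.map fun p => p.coeff 1) * sl2Diff hφ (q.map fun p => p.coeff 1) -
        sl2Diff hφ (q.map fun p => p.coeff 1) * sl2Diff hφ (q'.map fun p => p.coeff 1) := by
  set Y' := q'.map (fun p => p.coeff 1) with hY'
  set Y := q.map (fun p => p.coeff 1) with hY
  -- the polynomial matrices `dφ (q'(s) Y adj q'(s))` and `φ(q'(s)) (dφ Y) φ(adj q'(s))`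
  set Aq : Matrix (Fin 2) (Fin 2) k[X] := q' * Y.map C * q'.adjugate with hAq
  set SD : Matrix n n k[X] := Matrix.of fun i j => ∑ ab : Fin 2 × Fin 2, C (dcoef hφ ab i j) * Aq ab.1 ab.2
    with hSD
  set Bq : Matrix n n k[X] := compMat hφ q' * (sl2Diff hφ Y).map C * compMat hφ q'.adjugate with hBq
  have hpoly : SD = Bq := by
    refine polyMatrix_ext fun s => ?_
    -- right-hand side at `s`
    have hB : Bq.map (Polynomial.eval s) =
        phiMat φ (curveSL2 q' hq' s) * sl2Diff hφ Y * phiMat φ (curveSL2 q' hq' s)⁻¹ := by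
      rw [hBq, ← Polynomial.coe_evalRingHom, Matrix.map_mul, Matrix.map_mul, Polynomial.coe_evalRingHom,
        map_eval_compMat hφ q' hq', map_C_map_eval, map_eval_compMat hφ _ (det_adjugate_eq_one q' hq'),
        curveSL2_adjugate]
    -- left-hand side at `s`
    have hA : Aq.map (Polynomial.eval s) = (curveSL2 q' hq' s : Matrix (Fin 2) (Fin 2) k) * Y *
        (((curveSL2 q' hq' s)⁻¹ : SL(2, k)) : Matrix (Fin 2) (Fin 2) k) := by
      rw [hAq, ← Polynomial.coe_evalRingHom, Matrix.map_mul, Matrix.map_mul, Polynomial.coe_evalRingHom,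
        map_C_map_eval, coe_curveSL2, Matrix.SpecialLinearGroup.coe_inv, coe_curveSL2, map_eval_adjugate]
    have hS : SD.map (Polynomial.eval s) = sl2Diff hφ (Aq.map (Polynomial.eval s)) := by
      ext i j : 1
      rw [Matrix.map_apply, hSD, Matrix.of_apply, Polynomial.eval_finsetSum, sl2Diff_apply]
      refine Finset.sum_congr rfl fun ab _ => ?_
      rw [Polynomial.eval_mul, Polynomial.eval_C, Matrix.map_apply]
    rw [hS, hA, hB, hY, sl2Diff_conj hφ (curveSL2 q' hq' s) q hq h0]
  -- reduce modulo `s²`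
  have hAred : Aq.map (epsRed k) = Y.map (algebraMap k k[ε]) + (Y' * Y - Y * Y').map inr := by
    rw [hAq, ← AlgHom.coe_toRingHom, Matrix.map_mul, Matrix.map_mul, AlgHom.coe_toRingHom,
      map_C_map_epsRed, map_epsRed_eq_dualMatrix q' h0',
      map_epsRed_eq_dualMatrix q'.adjugate (adjugate_coeff_zero q' h0'), adjugate_coeff_one q' hq' h0',
      ← hY', dualMatrix_mul_map_mul_dualMatrix_neg]
  have hSred : ∀ i j, snd (SD.map (epsRed k) i j) = sl2Diff hφ (Y' * Y - Y * Y') i j := by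
    intro i j
    rw [Matrix.map_apply, hSD, Matrix.of_apply, map_sum, TrivSqZeroExt.snd_sum, sl2Diff_apply]
    refine Finset.sum_congr rfl fun ab _ => ?_
    have hab : epsRed k (Aq ab.1 ab.2) = inl (Y ab.1 ab.2) + inr ((Y' * Y - Y * Y') ab.1 ab.2) := by
      have h := congrFun (congrFun hAred ab.1) ab.2
      rw [Matrix.map_apply, Matrix.add_apply, Matrix.map_apply, Matrix.map_apply,
        TrivSqZeroExt.algebraMap_eq_inl] at h
      exact h
    rw [map_mul, Polynomial.aeval_C, TrivSqZeroExt.algebraMap_eq_inl, hab, TrivSqZeroExt.snd_mul]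
    simp
  have hBred : Bq.map (epsRed k) = (sl2Diff hφ Y).map (algebraMap k k[ε]) +
      (sl2Diff hφ Y' * sl2Diff hφ Y - sl2Diff hφ Y * sl2Diff hφ Y').map inr := by
    rw [hBq, ← AlgHom.coe_toRingHom, Matrix.map_mul, Matrix.map_mul, AlgHom.coe_toRingHom,
      map_C_map_epsRed, map_epsRed_compMat hφ q' hq' h0', ← hY',
      map_epsRed_compMat hφ q'.adjugate (det_adjugate_eq_one q' hq') (adjugate_coeff_zero q' h0'),
      adjugate_coeff_one q' hq' h0', ← hY', sl2Diff_neg, dualMatrix_mul_map_mul_dualMatrix_neg]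
  ext i j
  have h := hSred i j
  rw [hpoly, hBred, Matrix.add_apply, Matrix.map_apply, Matrix.map_apply, snd_add,
    TrivSqZeroExt.algebraMap_eq_inl, snd_inl, snd_inr, zero_add] at h
  exact h.symm

end Bracket2

/-! ### Torus weights of `dφ` of a root homomorphism; non-vanishing -/

section Weights

variable {G : Subgroup (GL n k)} {φ : SL(2, k) →* ↥G} (hφ : IsAlgebraicSL2Hom φ)

/-- The linear coefficients of the composite family form `dφ (q'(0))`. [folklore] -/
lemma map_coeff_one_compMat (q : Matrix (Fin 2) (Fin 2) k[X]) (h0 : q.map (fun p => p.coeff 0) = 1) :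
    (compMat hφ q).map (fun p => p.coeff 1) = sl2Diff hφ (q.map fun p => p.coeff 1) := by
  ext i j : 1
  rw [Matrix.map_apply, compMat, Matrix.of_apply, coeff_one_compFam hφ q h0]

/-- **Equivariance under a reparametrising conjugation**: if `t φ(q(x)) t⁻¹ = φ(q(c x))` for all
`x` (as for a root homomorphism `x ↦ φ(q(x))` normalised by a torus element `t` with `α(t) = c`),
then `t (dφ q'(0)) t⁻¹ = c · dφ q'(0)` — comparing linear coefficients. [folklore] -/
theorem conj_sl2Diff_eq_smul [Infinite k] (q : Matrix (Fin 2) (Fin 2) k[X]) (hq : q.det = 1)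
    (h0 : q.map (fun p => p.coeff 0) = 1) (t : GL n k) (c : k)
    (hconj : ∀ x : k, (t : Matrix n n k) * phiMat φ (curveSL2 q hq x) * ((t⁻¹ : GL n k) : Matrix n n k) =
      phiMat φ (curveSL2 q hq (c * x))) :
    (t : Matrix n n k) * sl2Diff hφ (q.map fun p => p.coeff 1) * ((t⁻¹ : GL n k) : Matrix n n k) =
      c • sl2Diff hφ (q.map fun p => p.coeff 1) := by
  have hpoly : (t : Matrix n n k).map C * compMat hφ q * ((t⁻¹ : GL n k) : Matrix n n k).map C =
      (compMat hφ q).map fun p => p.comp (C c * X) := by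
    refine polyMatrix_ext fun x => ?_
    rw [← Polynomial.coe_evalRingHom, Matrix.map_mul, Matrix.map_mul, Polynomial.coe_evalRingHom,
      map_C_map_eval, map_C_map_eval, map_eval_compMat hφ q hq, map_eval_comp_C_mul_X,
      map_eval_compMat hφ q hq]
    exact hconj x
  have h : ((t : Matrix n n k).map C * compMat hφ q * ((t⁻¹ : GL n k) : Matrix n n k).map C).map
      (fun p => p.coeff 1) = ((compMat hφ q).map fun p => p.comp (C c * X)).map (fun p => p.coeff 1) := by
    rw [hpoly]
  rwa [map_coeff_C_mul_mul_C, map_coeff_one_comp_C_mul_X, map_coeff_one_compMat hφ q h0] at h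

/-- `x ↦ φ(qUpper(x))` is `φ ∘ u⁺`. [folklore] -/
lemma phiMat_curveSL2_qUpper (x : k) :
    phiMat φ (curveSL2 qUpper det_qUpper x) =
      (((φ.comp unipotentUpperSL2 (Multiplicative.ofAdd x) : ↥G) : GL n k) : Matrix n n k) := by
  rw [curveSL2_qUpper]; rfl

/-- `x ↦ φ(qLower(x))` is `φ ∘ u⁻`. [folklore] -/
lemma phiMat_curveSL2_qLower (x : k) :
    phiMat φ (curveSL2 qLower det_qLower x) =
      (((φ.comp unipotentLowerSL2 (Multiplicative.ofAdd x) : ↥G) : GL n k) : Matrix n n k) := by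
  rw [curveSL2_qLower]; rfl

variable {T : Subgroup (GL n k)} {hTG : T ≤ G}

/-- From a root homomorphism `x ↦ φ(q(x))` with character `α`: the conjugation identity in matrix
form. [folklore] -/
lemma conj_eq_of_isRootHom {α : ↥T →* kˣ} {u : Multiplicative k →* ↥G} (hu : IsRootHom G T hTG α u)
    (q : Matrix (Fin 2) (Fin 2) k[X]) (hq : q.det = 1)
    (hqu : ∀ x : k, phiMat φ (curveSL2 q hq x) = (((u (Multiplicative.ofAdd x) : ↥G) : GL n k) : Matrix n n k))
    (t : ↥T) (x : k) :
    ((t : GL n k) : Matrix n n k) * phiMat φ (curveSL2 q hq x) * ((((t : GL n k))⁻¹ : GL n k) : Matrix n n k) =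
      phiMat φ (curveSL2 q hq ((α t : k) * x)) := by
  rw [hqu, hqu]
  have h := congrArg (fun g : ↥G => ((g : GL n k) : Matrix n n k)) (hu.2.2 t x)
  simp only [Subgroup.coe_mul, Subgroup.coe_inv, Subgroup.coe_inclusion, Units.val_mul] at h
  exact h

/-- **`dφ E` is a weight vector of weight `α`** when `φ ∘ u⁺` is a root homomorphism for `α`
(Springer 8.1.1 (i): `Im du_α ⊆ 𝔤_α`; compare `IsRootHom.velocity_mem_weightSpaceGL` of
`IsomorphismTheoremUniqueLie.lean`, the same statement for the velocity of a one-parameter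
subgroup — see the module docstring for the bridge). [cite: SpringerLAG1998, 8.1.1 (i)] -/
theorem sl2Diff_slE_mem_weightSpaceGL [Infinite k] {α : ↥T →* kˣ}
    (hu : IsRootHom G T hTG α (φ.comp unipotentUpperSL2)) : sl2Diff hφ slE ∈ weightSpaceGL T α := by
  intro t
  rw [← Matrix.coe_units_inv, ← qUpper_coeff_one]
  exact conj_sl2Diff_eq_smul hφ qUpper det_qUpper qUpper_coeff_zero (t : GL n k) (α t : k)
    (conj_eq_of_isRootHom hu qUpper det_qUpper (phiMat_curveSL2_qUpper) t)

/-- **`dφ F` is a weight vector of weight `α⁻¹`** when `φ ∘ u⁻` is a root homomorphism for `α⁻¹`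
(compare `IsRootHom.velocity_mem_weightSpaceGL` of `IsomorphismTheoremUniqueLie.lean`).
[cite: SpringerLAG1998, 8.1.1 (i)] -/
theorem sl2Diff_slF_mem_weightSpaceGL [Infinite k] {α : ↥T →* kˣ}
    (hu : IsRootHom G T hTG α⁻¹ (φ.comp unipotentLowerSL2)) : sl2Diff hφ slF ∈ weightSpaceGL T α⁻¹ := by
  intro t
  rw [← Matrix.coe_units_inv, ← qLower_coeff_one]
  exact conj_sl2Diff_eq_smul hφ qLower det_qLower qLower_coeff_zero (t : GL n k) ((α⁻¹ : ↥T →* kˣ) t : k)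
    (conj_eq_of_isRootHom hu qLower det_qLower (phiMat_curveSL2_qLower) t)

/-- **`dφ q'(0) ≠ 0` when `x ↦ φ(q(x))` has a regular retraction** (the "isomorphism onto a closed
subgroup" clause of `IsRootHom`): if `r (φ(q(x))) = x` for a polynomial `r` in the coordinates,
reduce `r ∘ (compFam q) = X` modulo `s²` (characteristic-free; compare `IsAlgebraicAddHom.velocity_ne_zero`
of `IsomorphismTheoremUniqueLie.lean`, for non-trivial one-parameter subgroups in characteristic `0`).
[folklore] -/
theorem sl2Diff_ne_zero_of_retraction [Infinite k] (q : Matrix (Fin 2) (Fin 2) k[X]) (hq : q.det = 1)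
    (h0 : q.map (fun p => p.coeff 0) = 1) {r : MvPolynomial (GLCoord n) k}
    (hr : ∀ x : k, MvPolynomial.eval (glCoordFun ((φ (curveSL2 q hq x) : ↥G) : GL n k)) r = x) :
    sl2Diff hφ (q.map fun p => p.coeff 1) ≠ 0 := by
  intro hzero
  -- `r ∘ compFam = X`
  have hX : MvPolynomial.aeval (compFam hφ q) r = (X : k[X]) := by
    refine Polynomial.funext fun x => ?_
    rw [MvPolynomial.aeval_def, Polynomial.algebraMap_eq, eval_mvPolynomialEval₂_C, Polynomial.eval_X]
    have hf : (fun c => (compFam hφ q c).eval x) = glCoordFun ((φ (curveSL2 q hq x) : ↥G) : GL n k) :=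
      funext fun c => eval_compFam hφ q hq x c
    rw [hf, hr]
  -- modulo `s²` the family is the constant point `1`
  have hred : ∀ c, epsRed k (compFam hφ q c) = algebraMap k k[ε] (glCoordFun (1 : GL n k) c) := by
    have hmat : (compMat hφ q).map (epsRed k) = 1 := by
      rw [map_epsRed_compMat hφ q hq h0, hzero, dualMatrix]
      have hz : (0 : Matrix n n k).map (inr : k → k[ε]) = 0 := by
        ext i j : 1; rw [Matrix.map_apply, Matrix.zero_apply, Matrix.zero_apply, inr_zero]
      rw [hz, add_zero]
    -- the `det⁻¹` coordinate: `y · det = 1`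
    have hdet : compFam hφ q (Sum.inr ()) * (compMat hφ q).det = 1 := by
      refine Polynomial.funext fun x => ?_
      rw [Polynomial.eval_mul, Polynomial.eval_one, eval_compFam hφ q hq, ← Polynomial.coe_evalRingHom,
        RingHom.map_det, RingHom.mapMatrix_apply, Polynomial.coe_evalRingHom, map_eval_compMat hφ q hq,
        glCoordFun_inr]
      exact inv_mul_cancel₀ (Matrix.isUnits_det_units _).ne_zero
    rintro (⟨i, j⟩ | ⟨⟩)
    · have h := congrFun (congrFun hmat i) j
      rw [Matrix.map_apply, compMat, Matrix.of_apply] at h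
      rw [h, glCoordFun_inl, Units.val_one, Matrix.one_apply, Matrix.one_apply]
      split_ifs <;> simp [TrivSqZeroExt.algebraMap_eq_inl]
    · have h := congrArg (epsRed k) hdet
      rw [map_mul, map_one, AlgHom.map_det] at h
      change epsRed k (compFam hφ q (Sum.inr ())) * ((compMat hφ q).map (epsRed k)).det = 1 at h
      rw [hmat, Matrix.det_one, mul_one] at h
      rw [h, glCoordFun_inr, Units.val_one, Matrix.det_one, inv_one, map_one]
  -- hence `r` reduces to a constant: contradiction with `ε`
  have h := congrArg (epsRed k) hX
  rw [Polynomial.aeval_X, ← AlgHom.comp_apply, MvPolynomial.comp_aeval] at h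
  have hpt : (fun c => epsRed k (compFam hφ q c)) = fun c => algebraMap k k[ε] (glCoordFun (1 : GL n k) c) :=
    funext hred
  rw [hpt] at h
  have halg : (MvPolynomial.aeval fun c => algebraMap k k[ε] (glCoordFun (1 : GL n k) c)) =
      (Algebra.ofId k k[ε]).comp (MvPolynomial.aeval (glCoordFun (1 : GL n k))) :=
    MvPolynomial.algHom_ext fun c => by simp
  rw [halg, AlgHom.comp_apply, Algebra.ofId_apply, TrivSqZeroExt.algebraMap_eq_inl] at h
  have h2 := congrArg snd h
  rw [snd_inl, DualNumber.snd_eps] at h2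
  exact zero_ne_one h2

end Weights

end Literature.NumberTheory.Automorphic
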